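import Summits.KontsevichZagierPeriods.KontsevichZagierPeriods.Theorems.LinRedNormalFormDihedralNormalFormStubTorusDescentAux1

/-!
# `DihedralNormalForm`, line `torus-descent-sum-shadow`, stub `stub_torusDescent` — the straightening map (Aux 2)

Support file for the stub `stub_torusDescent` of the crux `DihedralNormalForm`
(stmt-KontsevichZagierPeriods-3912, route `LinRedNormalForm`). The geometry of ONE torus descent
in coordinates where the entry face is the last coordinate:

* `wedge μ` — the part `{z ∈ (0,1)ᵏ⁺¹ | μ_j = −1 ⇒ z_j < z_last}` of the open cube (the entry
  piece, resp. the open band of the Newton–Leibniz move, is `wedge μ`, resp. `wedge (−μ)`,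
  `μ = lam ∘ p.succAbove`);
* `str ν` — the monomial straightening map `z ↦ ((z_j z_last^{ν_j})_j, z_last)`: a bijection
  `wedge μ → wedge (−μ)` with inverse `str (−μ)` (`mapsTo_str`, `image_str`, `injOn_str`), a
  `ℚ`-semialgebraic map, differentiable off `z_last = 0` with upper-triangular derivative
  `strDeriv` of determinant `z_last^{Σ ν}` (`hasFDerivAt_str`, `det_strDeriv`);
* `atomFun_insertNth_scaled` — torus homogeneity of the atom integrand: substituting
  `x_p = t`, `x_{p.succAbove j} = y_j t^{−lam_j}` multiplies `g₀` by `t^{−Σ lam·a}` when `lam` is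
  orthogonal to every active chord (the chord monomials are unchanged).

References: M. Kontsevich, D. Zagier, *Periods* (2001), §1.2 (rule (2)).
-/

noncomputable section

open MeasureTheory Set MvPolynomial
open scoped ENNReal
open Literature.ModelTheory.ExponentialFields (IsSemialgebraic)

namespace Summit.KontsevichZagierPeriods.DihedralNormalForm.TorusDescent

open Literature.NumberTheory.Transcendental
open Literature.ModelTheory.ExponentialFields

/-! ### Wedges of the open cube and the straightening map -/

variable {k : ℕ}

/-- The wedge of the open cube `(0,1)ᵏ⁺¹` on which the `−1`-coordinates of `μ` lie below the last
coordinate: `{z | 0 < z_i < 1, μ_j = −1 ⇒ z_j < z_last}`. -/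
def wedge (μ : Fin k → ℤ) : Set (Fin (k + 1) → ℝ) :=
  {z | (∀ i, z i ∈ Ioo (0:ℝ) 1) ∧ ∀ j : Fin k, μ j = -1 → z (Fin.castSucc j) < z (Fin.last k)}

/-- The monomial straightening map `z ↦ (z_j · z_last^{ν_j})_j, z_last`. -/
def str (ν : Fin k → ℤ) (z : Fin (k + 1) → ℝ) : Fin (k + 1) → ℝ :=
  Fin.snoc (fun j => z (Fin.castSucc j) * z (Fin.last k) ^ ν j) (z (Fin.last k))

/-- The last coordinate is unchanged by the straightening map. [folklore] -/
@[simp] theorem str_last (ν : Fin k → ℤ) (z : Fin (k + 1) → ℝ) :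
    str ν z (Fin.last k) = z (Fin.last k) := by
  simp [str]

/-- The other coordinates are scaled by monomials in the last one. [folklore] -/
@[simp] theorem str_castSucc (ν : Fin k → ℤ) (z : Fin (k + 1) → ℝ) (j : Fin k) :
    str ν z (Fin.castSucc j) = z (Fin.castSucc j) * z (Fin.last k) ^ ν j := by
  simp [str]

/-- `Fin.init (str ν z)`. [folklore] -/
theorem init_str (ν : Fin k → ℤ) (z : Fin (k + 1) → ℝ) :
    Fin.init (str ν z) = fun j => z (Fin.castSucc j) * z (Fin.last k) ^ ν j := by
  ext j
  simp [Fin.init]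

/-- Straightening maps compose by adding exponents (off `z_last = 0`). [folklore] -/
theorem str_str (ν ν' : Fin k → ℤ) {z : Fin (k + 1) → ℝ} (hz : z (Fin.last k) ≠ 0) :
    str ν (str ν' z) = str (ν + ν') z := by
  ext i
  refine Fin.lastCases ?_ (fun j => ?_) i
  · simp
  · simp only [str_castSucc, str_last, Pi.add_apply]
    rw [zpow_add₀ hz]
    ring

/-- The straightening map with zero exponents is the identity. [folklore] -/
theorem str_zero (z : Fin (k + 1) → ℝ) : str (0 : Fin k → ℤ) z = z := by
  ext i
  refine Fin.lastCases ?_ (fun j => ?_) i <;> simp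

/-- `str (−ν)` inverts `str ν` off `z_last = 0`. [folklore] -/
theorem str_neg_str (ν : Fin k → ℤ) {z : Fin (k + 1) → ℝ} (hz : z (Fin.last k) ≠ 0) :
    str (-ν) (str ν z) = z := by
  rw [str_str _ _ hz, neg_add_cancel, str_zero]

/-- Points of a wedge have positive last coordinate. [folklore] -/
theorem last_pos_of_mem_wedge {μ : Fin k → ℤ} {z : Fin (k + 1) → ℝ} (hz : z ∈ wedge μ) :
    0 < z (Fin.last k) := (hz.1 _).1

/-- **The straightening map sends `wedge μ` into `wedge (−μ)`** (for `μ ∈ {0, ±1}ᵏ`): the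
`−1`-coordinates are divided by `z_last` (their constraint disappears), the `+1`-coordinates are
multiplied by it (their constraint appears). [folklore] -/
theorem mapsTo_str {μ : Fin k → ℤ} (hμ : ∀ j, μ j = 0 ∨ μ j = 1 ∨ μ j = -1) :
    MapsTo (str μ) (wedge μ) (wedge (-μ)) := by
  intro z hz
  obtain ⟨hcube, hlt⟩ := hz
  have hs := hcube (Fin.last k)
  refine ⟨fun i => ?_, fun j hj => ?_⟩
  · refine Fin.lastCases ?_ (fun j => ?_) i
    · simpa using hs
    · have hj := hcube (Fin.castSucc j)
      rw [str_castSucc]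
      rcases hμ j with h | h | h
      · simpa [h] using hj
      · rw [h, zpow_one]
        exact ⟨mul_pos hj.1 hs.1, mul_lt_one_of_nonneg_of_lt_one_left hj.1.le hj.2 hs.2.le⟩
      · rw [h, zpow_neg, zpow_one, ← div_eq_mul_inv]
        exact ⟨div_pos hj.1 hs.1, (div_lt_one hs.1).2 (hlt j h)⟩
  · have h1 : μ j = 1 := by simpa using hj
    have hj' := hcube (Fin.castSucc j)
    rw [str_castSucc, str_last, h1, zpow_one]
    exact mul_lt_of_lt_one_left hs.1 hj'.2

/-- Negation preserves `{0, ±1}`-valued vectors. [folklore] -/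
theorem neg_mem_signs {μ : Fin k → ℤ} (hμ : ∀ j, μ j = 0 ∨ μ j = 1 ∨ μ j = -1) :
    ∀ j, (-μ) j = 0 ∨ (-μ) j = 1 ∨ (-μ) j = -1 := fun j => by
  rcases hμ j with h | h | h <;> simp [h]

/-- **The straightening map is a bijection `wedge μ → wedge (−μ)`**: its image. [folklore] -/
theorem image_str {μ : Fin k → ℤ} (hμ : ∀ j, μ j = 0 ∨ μ j = 1 ∨ μ j = -1) :
    str μ '' wedge μ = wedge (-μ) := by
  refine (mapsTo_str hμ).image_subset.antisymm fun w hw => ?_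
  have hw0 : w (Fin.last k) ≠ 0 := (last_pos_of_mem_wedge hw).ne'
  refine ⟨str (-μ) w, ?_, ?_⟩
  · simpa using mapsTo_str (neg_mem_signs hμ) hw
  · rw [str_str _ _ hw0, add_neg_cancel, str_zero]

/-- The straightening map is injective on the wedge. [folklore] -/
theorem injOn_str (μ : Fin k → ℤ) : InjOn (str μ) (wedge μ) := by
  intro z hz z' hz' h
  rw [← str_neg_str μ (last_pos_of_mem_wedge hz).ne', h,
    str_neg_str μ (last_pos_of_mem_wedge hz').ne']

/-- A wedge is cut out of the open cube by polynomial strict inequalities, hence is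
`ℚ`-semialgebraic. [cite: BochnakCosteRoy1998, §2.1] -/
theorem isSemialgebraic_wedge (μ : Fin k → ℤ) : IsSemialgebraic ℚ (wedge μ) := by
  classical
  have h : wedge μ = openUnitCube (k + 1) ∩
      ⋂ j ∈ Finset.univ.filter (fun j : Fin k => μ j = -1),
        {z : Fin (k + 1) → ℝ | z (Fin.castSucc j) < z (Fin.last k)} := by
    ext z
    simp [wedge, openUnitCube]
  rw [h]
  refine isSemialgebraic_openUnitCube.inter (IsSemialgebraic.biInter _ _ fun j _ => ?_)
  simpa using isSemialgebraic_setOf_eval_lt (k := ℚ) (R := ℝ)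
    (X (Fin.castSucc j) : MvPolynomial (Fin (k + 1)) ℚ) (X (Fin.last k))

/-- Wedges are measurable. [folklore] -/
theorem measurableSet_wedge (μ : Fin k → ℤ) : MeasurableSet (wedge μ) :=
  IsSemialgebraic.measurableSet_holds (isSemialgebraic_wedge μ)

/-- A wedge lies in the open cube. [folklore] -/
theorem wedge_subset_openUnitCube (μ : Fin k → ℤ) : wedge μ ⊆ openUnitCube (k + 1) :=
  fun _ hz => hz.1

/-- The straightening map is a `ℚ`-semialgebraic map on every `ℚ`-semialgebraic set (coordinates:
a coordinate times an integer power of a coordinate). [cite: BochnakCosteRoy1998, Prop. 2.2.6] -/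
theorem isSemialgebraicMapOn_str (ν : Fin k → ℤ) {S : Set (Fin (k + 1) → ℝ)}
    (hS : IsSemialgebraic ℚ S) : IsSemialgebraicMapOn ℚ S (str ν) := by
  refine IsSemialgebraicMapOn.of_forall hS fun i => ?_
  refine Fin.lastCases ?_ (fun j => ?_) i
  · exact (isSemialgebraicFunOn_apply hS (Fin.last k)).congr fun z _ => (str_last ν z).symm
  · exact ((isSemialgebraicFunOn_apply hS (Fin.castSucc j)).fun_mul
      (fun_zpow (isSemialgebraicFunOn_apply hS (Fin.last k)) (ν j))).congr
        fun z _ => (str_castSucc ν z j).symm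

/-! ### The derivative of the straightening map and its Jacobian -/

/-- The derivative of `str ν` at `z` (Leibniz rule coordinatewise). -/
def strDeriv (ν : Fin k → ℤ) (z : Fin (k + 1) → ℝ) : (Fin (k + 1) → ℝ) →L[ℝ] (Fin (k + 1) → ℝ) :=
  ContinuousLinearMap.pi (Fin.snoc (α := fun _ : Fin (k + 1) => (Fin (k + 1) → ℝ) →L[ℝ] ℝ)
    (fun j => z (Fin.castSucc j) • (((ν j : ℝ) * z (Fin.last k) ^ (ν j - 1)) •
        ContinuousLinearMap.proj (R := ℝ) (φ := fun _ : Fin (k + 1) => ℝ) (Fin.last k)) +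
      (z (Fin.last k) ^ ν j) •
        ContinuousLinearMap.proj (R := ℝ) (φ := fun _ : Fin (k + 1) => ℝ) (Fin.castSucc j))
    (ContinuousLinearMap.proj (R := ℝ) (φ := fun _ : Fin (k + 1) => ℝ) (Fin.last k)))

/-- The last component of `strDeriv`. [folklore] -/
theorem strDeriv_apply_last (ν : Fin k → ℤ) (z v : Fin (k + 1) → ℝ) :
    strDeriv ν z v (Fin.last k) = v (Fin.last k) := by
  simp [strDeriv]

/-- The other components of `strDeriv`. [folklore] -/
theorem strDeriv_apply_castSucc (ν : Fin k → ℤ) (z v : Fin (k + 1) → ℝ) (j : Fin k) :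
    strDeriv ν z v (Fin.castSucc j) =
      z (Fin.castSucc j) * (((ν j : ℝ) * z (Fin.last k) ^ (ν j - 1)) * v (Fin.last k)) +
        z (Fin.last k) ^ ν j * v (Fin.castSucc j) := by
  simp [strDeriv, smul_eq_mul]

/-- **Differentiability of the straightening map** off `z_last = 0`. [folklore] -/
theorem hasFDerivAt_str (ν : Fin k → ℤ) {z : Fin (k + 1) → ℝ} (hz : z (Fin.last k) ≠ 0) :
    HasFDerivAt (str ν) (strDeriv ν z) z := by
  refine hasFDerivAt_pi'.2 fun i => ?_
  refine Fin.lastCases ?_ (fun j => ?_) i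
  · have h : (ContinuousLinearMap.proj (R := ℝ) (Fin.last k)).comp (strDeriv ν z) =
        ContinuousLinearMap.proj (R := ℝ) (φ := fun _ : Fin (k + 1) => ℝ) (Fin.last k) := by
      ext v
      simp [strDeriv_apply_last]
    rw [h]
    simpa only [str_last] using hasFDerivAt_apply (𝕜 := ℝ) (Fin.last k) z
  · have h : (ContinuousLinearMap.proj (R := ℝ) (Fin.castSucc j)).comp (strDeriv ν z) =
        z (Fin.castSucc j) • (((ν j : ℝ) * z (Fin.last k) ^ (ν j - 1)) •
          ContinuousLinearMap.proj (R := ℝ) (φ := fun _ : Fin (k + 1) => ℝ) (Fin.last k)) +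
        (z (Fin.last k) ^ ν j) •
          ContinuousLinearMap.proj (R := ℝ) (φ := fun _ : Fin (k + 1) => ℝ) (Fin.castSucc j) := by
      ext v
      simp [strDeriv_apply_castSucc, smul_eq_mul]
    rw [h]
    have h1 := hasFDerivAt_apply (𝕜 := ℝ) (Fin.castSucc j) z
    have hd : HasDerivAt (fun t : ℝ => t ^ ν j) ((ν j : ℝ) * z (Fin.last k) ^ (ν j - 1))
        (z (Fin.last k)) := hasDerivAt_zpow (ν j) (z (Fin.last k)) (Or.inl hz)
    have h2 : HasFDerivAt (fun x : Fin (k + 1) → ℝ => x (Fin.last k) ^ ν j)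
        (((ν j : ℝ) * z (Fin.last k) ^ (ν j - 1)) •
          ContinuousLinearMap.proj (R := ℝ) (φ := fun _ : Fin (k + 1) => ℝ) (Fin.last k)) z :=
      hd.comp_hasFDerivAt_of_eq z (hasFDerivAt_apply (𝕜 := ℝ) (Fin.last k) z) rfl
    have hfun : (fun x => str ν x (Fin.castSucc j)) =
        fun x : Fin (k + 1) → ℝ => x (Fin.castSucc j) * x (Fin.last k) ^ ν j :=
      funext fun x => str_castSucc ν x j
    rw [hfun]
    exact h1.mul h2

/-- **The Jacobian of the straightening map**: `det (strDeriv ν z) = z_last^{Σ ν}` (the matrix is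
upper triangular with diagonal `z_last^{ν_j}` and `1`). [folklore] -/
theorem det_strDeriv (ν : Fin k → ℤ) {z : Fin (k + 1) → ℝ} (hz : z (Fin.last k) ≠ 0) :
    (strDeriv ν z).det = z (Fin.last k) ^ (∑ j, ν j) := by
  classical
  set L := strDeriv ν z with hL
  have hentry : ∀ i m, LinearMap.toMatrix' (L : (Fin (k + 1) → ℝ) →ₗ[ℝ] (Fin (k + 1) → ℝ)) i m =
      L (Pi.single m 1) i := fun i m => LinearMap.toMatrix'_apply _ i m
  have hdet : L.det =
      (LinearMap.toMatrix' (L : (Fin (k + 1) → ℝ) →ₗ[ℝ] (Fin (k + 1) → ℝ))).det := by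
    rw [ContinuousLinearMap.det, LinearMap.det_toMatrix']
  rw [hdet, Matrix.det_of_upperTriangular ?_]
  · rw [Fin.prod_univ_castSucc]
    have hlast : LinearMap.toMatrix' (L : (Fin (k + 1) → ℝ) →ₗ[ℝ] (Fin (k + 1) → ℝ))
        (Fin.last k) (Fin.last k) = 1 := by
      rw [hentry, hL, strDeriv_apply_last]
      simp
    have hdiag : ∀ j : Fin k, LinearMap.toMatrix' (L : (Fin (k + 1) → ℝ) →ₗ[ℝ] (Fin (k + 1) → ℝ))
        (Fin.castSucc j) (Fin.castSucc j) = z (Fin.last k) ^ ν j := by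
      intro j
      rw [hentry, hL, strDeriv_apply_castSucc]
      simp
    simp_rw [hdiag, hlast, mul_one]
    exact prod_zpow_eq_zpow_sum _ _ hz
  · intro i m him
    change m < i at him
    rw [hentry, hL]
    refine Fin.lastCases ?_ (fun j => ?_) i him
    · intro him
      rw [strDeriv_apply_last, Pi.single_eq_of_ne him.ne']
    · intro him
      have h1 : m ≠ Fin.last k := (him.trans (Fin.castSucc_lt_last j)).ne
      rw [strDeriv_apply_castSucc, Pi.single_eq_of_ne' him.ne, Pi.single_eq_of_ne' h1]
      ring

/-- `|det (strDeriv ν z)| = z_last^{Σ ν}` for `z_last > 0`. [folklore] -/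
theorem abs_det_strDeriv (ν : Fin k → ℤ) {z : Fin (k + 1) → ℝ} (hz : 0 < z (Fin.last k)) :
    |(strDeriv ν z).det| = z (Fin.last k) ^ (∑ j, ν j) := by
  rw [det_strDeriv ν hz.ne', abs_of_pos (zpow_pos hz _)]

/-! ### The atom integrand along the straightened orbit -/

/-- **Torus homogeneity of the atom integrand.** For a direction `lam` with `lam p = −1`
orthogonal to every active chord, substituting `x_p = t`, `x_{p.succAbove j} = y_j t^{−lam_j}`
scales `g₀` by `t^{−Σ lam·a}`: the active chord monomials are unchanged and the monomial part is
homogeneous. [folklore] -/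
theorem atomFun_insertNth_scaled (a : Fin (k + 1) → ℕ) (e : Fin (k + 1) → Fin (k + 1) → ℤ)
    (lam : Fin (k + 1) → ℤ) (p : Fin (k + 1)) (hp : lam p = -1)
    (hch : ∀ i j : Fin (k + 1), i ≤ j → e i j ≠ 0 →
      (∑ l : Fin (k + 1), if i ≤ l ∧ l ≤ j then lam l else 0) = 0)
    (y : Fin k → ℝ) {t : ℝ} (ht : t ≠ 0) :
    atomFun a e (Fin.insertNth p t (fun j => y j * t ^ (-lam (p.succAbove j)))) =
      atomFun a e (Fin.insertNth p 1 y) * t ^ (-(∑ l, lam l * (a l : ℤ))) := by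
  unfold atomFun
  -- the monomial part
  have hmono : (∏ i, (Fin.insertNth p t (fun j => y j * t ^ (-lam (p.succAbove j))) :
      Fin (k + 1) → ℝ) i ^ a i) =
      (∏ i, (Fin.insertNth p (1:ℝ) y : Fin (k + 1) → ℝ) i ^ a i) *
        t ^ (-(∑ l, lam l * (a l : ℤ))) := by
    rw [Fin.prod_univ_succAbove _ p, Fin.prod_univ_succAbove _ p]
    simp only [Fin.insertNth_apply_same, Fin.insertNth_apply_succAbove, one_pow, one_mul, mul_pow]
    rw [Finset.prod_mul_distrib]
    have hexp : -(∑ l, lam l * (a l : ℤ)) = (a p : ℤ) + ∑ j, (-lam (p.succAbove j)) * (a (p.succAbove j) : ℤ) := by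
      rw [Fin.sum_univ_succAbove _ p, hp]
      simp [Finset.sum_neg_distrib]
      ring
    rw [hexp, zpow_add₀ ht, zpow_natCast, ← prod_zpow_eq_zpow_sum _ _ ht]
    have hpow : ∀ j : Fin k, (t ^ (-lam (p.succAbove j))) ^ a (p.succAbove j) =
        t ^ (-lam (p.succAbove j) * (a (p.succAbove j) : ℤ)) := fun j => by
      rw [← zpow_natCast, ← zpow_mul]
    simp_rw [hpow]
    ring
  -- the chord part
  have hchord : ∀ i j : Fin (k + 1), i ≤ j →
      (1 - ∏ l, if i ≤ l ∧ l ≤ j then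
          (Fin.insertNth p t (fun j => y j * t ^ (-lam (p.succAbove j))) : Fin (k + 1) → ℝ) l
        else 1) ^ e i j =
      (1 - ∏ l, if i ≤ l ∧ l ≤ j then (Fin.insertNth p (1:ℝ) y : Fin (k + 1) → ℝ) l else 1) ^
        e i j := by
    intro i j hij
    by_cases he : e i j = 0
    · simp [he]
    congr 2
    rw [Fin.prod_univ_succAbove _ p, Fin.prod_univ_succAbove _ p]
    simp only [Fin.insertNth_apply_same, Fin.insertNth_apply_succAbove]
    -- split the scaled factors
    have hsplit : ∀ l : Fin k,
        (if i ≤ p.succAbove l ∧ p.succAbove l ≤ j then y l * t ^ (-lam (p.succAbove l)) else 1) =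
        (if i ≤ p.succAbove l ∧ p.succAbove l ≤ j then y l else 1) *
          t ^ (if i ≤ p.succAbove l ∧ p.succAbove l ≤ j then -lam (p.succAbove l) else 0) := by
      intro l
      split_ifs <;> simp
    have hfirst : (if i ≤ p ∧ p ≤ j then t else 1) = t ^ (if i ≤ p ∧ p ≤ j then (1:ℤ) else 0) := by
      split_ifs <;> simp
    simp_rw [hsplit, hfirst]
    rw [Finset.prod_mul_distrib, prod_zpow_eq_zpow_sum _ _ ht]
    have hsum := hch i j hij he
    rw [Fin.sum_univ_succAbove _ p, hp] at hsum
    have hex : (∑ l : Fin k,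
        (if i ≤ p.succAbove l ∧ p.succAbove l ≤ j then -lam (p.succAbove l) else 0)) +
          (if i ≤ p ∧ p ≤ j then (1:ℤ) else 0) = 0 := by
      have hneg : ∑ l : Fin k,
          (if i ≤ p.succAbove l ∧ p.succAbove l ≤ j then -lam (p.succAbove l) else 0) =
          -∑ l : Fin k, (if i ≤ p.succAbove l ∧ p.succAbove l ≤ j then lam (p.succAbove l) else 0) := by
        rw [← Finset.sum_neg_distrib]
        refine Finset.sum_congr rfl fun l _ => ?_
        split_ifs <;> simp
      rw [hneg]
      by_cases hpI : i ≤ p ∧ p ≤ j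
      · simp only [hpI, and_self, if_true] at hsum ⊢
        omega
      · simp only [hpI, if_false] at hsum ⊢
        omega
    simp only [ite_self, one_mul]
    rw [mul_comm (t ^ _) _, mul_assoc, ← zpow_add₀ ht, hex, zpow_zero, mul_one]
  rw [hmono]
  have hch' : (∏ i, ∏ j, if i ≤ j then (1 - ∏ l, if i ≤ l ∧ l ≤ j then
      (Fin.insertNth p t (fun j => y j * t ^ (-lam (p.succAbove j))) : Fin (k + 1) → ℝ) l
        else 1) ^ e i j else 1) =
      ∏ i, ∏ j, if i ≤ j then (1 - ∏ l, if i ≤ l ∧ l ≤ j then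
        (Fin.insertNth p (1:ℝ) y : Fin (k + 1) → ℝ) l else 1) ^ e i j else 1 := by
    refine Finset.prod_congr rfl fun i _ => Finset.prod_congr rfl fun j _ => ?_
    by_cases hij : i ≤ j
    · rw [if_pos hij, if_pos hij, hchord i j hij]
    · rw [if_neg hij, if_neg hij]
  rw [hch']
  ring


/-- Registered sub-goal `stub_torusDescentAux2` of `stub_torusDescent` (injectivity of the
monomial straightening map on its wedge). [folklore] -/
theorem stub_torusDescentAux2 : ∀ (k : ℕ) (μ : Fin k → ℤ), Set.InjOn (fun z : Fin (k + 1) → ℝ => (Fin.snoc (fun j : Fin k => z (Fin.castSucc j) * z (Fin.last k) ^ μ j) (z (Fin.last k)) : Fin (k + 1) → ℝ)) {z : Fin (k + 1) → ℝ | (∀ i, z i ∈ Set.Ioo (0:ℝ) 1) ∧ ∀ j : Fin k, μ j = -1 → z (Fin.castSucc j) < z (Fin.last k)} :=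
  fun _ μ => injOn_str μ

end Summit.KontsevichZagierPeriods.DihedralNormalForm.TorusDescent
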